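import Literature.NumberTheory.GaloisCohomology.Howard2004.CasselsTateSkewPairingEngineDecompositionsProofs
import Literature.NumberTheory.GaloisCohomology.Howard2004.CasselsTateSkewPairing
import HarnessLib

/-!
# Howard 2004, Lemma 1.6.4 ENGINE: the typed input `HasLevelDecompositionsAt` BY NAME from the print leaf
# `prop141_casselsTate_skewPairing_atLevel` (Prop. 1.4.1 / Flach + the display of the proof of Thm. 1.4.2) — proofs file

Topic `NumberTheory/GaloisCohomology/Howard2004`. THEOREMS ONLY: no definition, no named fact, no instance, no
notation, no `sorry`. The (α-PLUG) of the cell board `pub/bsd-print-x9` (seat `bsd-line-x9-p1` LEAD g9): the ENGINE's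
one typed-input slot `DVRSetting.HasLevelDecompositionsAt hy` (x10b-p1-w2 g16, `DVRSettingEngineStub`) — Howard's
«for `n ∈ 𝓝^{(k)}` we have a decomposition `H¹_{𝓕(n)}(K, T^{(k)}) ≅ R^{(k),ε} ⊕ M^{(k)}(n) ⊕ M^{(k)}(n)`» (§1.6 ¶1,
arXiv:1202.6340 p0011 L33–44) — is filled BY NAME from the cite-only print leaf
`Literature.NumberTheory.GaloisCohomology.Howard2004.prop141_casselsTate_skewPairing_atLevel` (lit g45, p703846:
Prop. 1.4.1's nondegenerate pairing `( , )_{s,1} : V_s × W_s → R[𝔪]` and the skew identity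
`(a, π^{s-1}b)_{s,1} = -(b, π^{s-1}a)_{s,1}` for `(T^{(k)}, 𝓕(n))`, `n ∈ 𝓝^{(k)}`, `s < e_k`), through the kernel
chain `hasLevelDecompositionsAt_of_skewPairings_display` (p703298) ∘ `exists_addEquiv_package_of_skewPairings_atLevel`
(p702772) ∘ `levelForms_of_skewPairings` (p702154) ∘ x10b-p1-w7's `PairedTorsionModules{DVR,Alternating}` (the
alternation, the kernel `V_{s-1}`, the even dimension of `V_s/V_{s-1}` and the structure theorem are kernel theorems).

* **`DVRSetting.hasLevelDecompositionsAt_of_prop141`** — `prop141_casselsTate_skewPairing_atLevel → S.HasLevelDecompositionsAt hy`;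
* `DVRSetting.hasLevelDecompositions_of_prop141` — the `𝓝(𝓛^{(2k-1)})`-keyed slot (`stubLength` / `stub`).

HONEST FRAMING: CONDITIONAL on the named fact (a hypothesis, cite-only, not proved in the tree); `thm161_dvrKolyvaginBound`
is NOT proved here; no summit statement is proved; the Birch–Swinnerton-Dyer conjecture is not proved by any of this.
-/

set_option autoImplicit false

noncomputable section

open Function NumberField IsDedekindDomain Field
open scoped NumberField ContRepresentation

namespace Literature.NumberTheory.GaloisCohomology.Howard2004

open Literature.NumberTheory.GaloisRepresentations
open Literature.NumberTheory.GaloisRepresentations.DiscreteGaloisModule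

namespace DVRSetting

variable {p : ℕ} [Fact p.Prime] {K : Type} [Field K] [NumberField K]
  {R : Type} [CommRing R] [IsDomain R] [IsDiscreteValuationRing R] [Algebra ℤ_[p] R]
  {N : ℕ → Type} [∀ k, AddCommGroup (N k)] [∀ k, TopologicalSpace (N k)]
  [∀ k, DiscreteTopology (N k)] [∀ k, Module R (N k)]
  {Rk : ℕ → Type} [∀ k, CommRing (Rk k)] [∀ k, IsLocalRing (Rk k)] [∀ k, TopologicalSpace (Rk k)]
  [∀ k, DiscreteTopology (Rk k)] [∀ k, Algebra ℤ_[p] (Rk k)] [∀ k, Algebra R (Rk k)]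
  [∀ k, Module (Rk k) (N k)] [∀ k, IsScalarTower R (Rk k) (N k)]
  {Nbar : Type} [AddCommGroup Nbar] [TopologicalSpace Nbar] [DiscreteTopology Nbar]
  [∀ k, Module (Rk k) Nbar]
  {Nq : ℕ → Finset (HeightOneSpectrum (𝓞 K)) → Type} [∀ k n, AddCommGroup (Nq k n)]
  [∀ k n, TopologicalSpace (Nq k n)] [∀ k n, DiscreteTopology (Nq k n)]
  [∀ k n, Module (Rk k) (Nq k n)] [∀ k n, Module R (Nq k n)]
  [∀ k n, IsScalarTower R (Rk k) (Nq k n)]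

/-- **(α-PLUG) THE ENGINE'S TYPED INPUT BY NAME.** On a `DVRSetting` with H.0–H.5, the print leaf
`prop141_casselsTate_skewPairing_atLevel` (Howard 2004 Prop. 1.4.1 after Flach 1990, with the two displayed sentences
of the proof of Thm. 1.4.2, for every `(T^{(k)}, 𝓕(n))`, `n ∈ 𝓝^{(k)}`) gives `S.HasLevelDecompositionsAt hy`: for every
level `k` and every `n ⊆ 𝓛^{(k)}` an additive `R`-equivariant `θ : H¹_{𝓕(n)}(K, T^{(k)}) ≃ (R/𝔪^{e_k})^ε × (M × M)`,
`ε ≤ 1`, `M` finite — Howard's Thm. 1.4.2 for `(T^{(k)}, 𝓕(n))`, IN THE KERNEL modulo that leaf.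
[cite: Howard2004HeegnerKolyvagin, Prop. 1.4.1, Thm. 1.4.2 (with proof) and §1.6 ¶1 (arXiv:1202.6340 p0008 L83–L142, p0011 L33–44)]
[cite: Flach1990, Thm. 1] -/
theorem hasLevelDecompositionsAt_of_prop141 (h141 : prop141_casselsTate_skewPairing_atLevel)
    (S : DVRSetting p K R N Rk Nbar Nq) (hy : S.SatisfiesH) : S.HasLevelDecompositionsAt hy :=
  S.hasLevelDecompositionsAt_of_skewPairings_display hy (h141 p K R N Rk Nbar Nq S hy)

/-- The `𝓝(𝓛^{(2k-1)})`-keyed slot `HasLevelDecompositions` (feeding `stubLength` / `stub`) from the same leaf.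
[cite: Howard2004HeegnerKolyvagin, Prop. 1.4.1, Thm. 1.4.2 (with proof) and §1.6 ¶1 (arXiv:1202.6340 p0008 L83–L142, p0011 L33–44)]
[cite: Flach1990, Thm. 1] -/
theorem hasLevelDecompositions_of_prop141 (h141 : prop141_casselsTate_skewPairing_atLevel)
    (S : DVRSetting p K R N Rk Nbar Nq) (hy : S.SatisfiesH) : S.HasLevelDecompositions hy :=
  (S.hasLevelDecompositionsAt_of_prop141 h141 hy).toHasLevelDecompositions

end DVRSetting

end Literature.NumberTheory.GaloisCohomology.Howard2004
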